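import Summits.AtomisticToContinuum.Crystallization.Theorems.OverbindingBudgetMisfitCensusStatements

/-!
# `GapFreeShells` ⟸ a one-shell covering-radius bound (cell `decomp-a2c`, lens-3 g27 — for the GEG leaf of cone XLI)

Cone XLI (`OverbindingBudgetMisfitCensus.rdef_of_ceg_meg`, the cut of record beneath `RobustDefectLimitWindows` since
2026-08-31T20:28Z) has the elastic residual `MisfitEnergyGap (122/125) 0 ⟸ ScaleEnergyGap (122/125) 0 ∧ GapFreeShells`
(`OverbindingBudgetMisfitCensusStatements.misfitEnergyGap_zero_of_scale_gapFree`, PROVED).  `GapFreeShells` is a statement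
about ONE `(1/100)`-charge-free site `i` of an arbitrary finite injective configuration (no hard core, no hypothesis on the
other sites): every site NOT bonded to `i` lies at distance `≥ 9/7 · nn_i`.  In particular it is NOT implied by the two-shell
slot `TwoShellShape (1/100) (3/50) (1/450)` as typed (that slot assumes `7/10`-separation and charge-free sites throughout the
`(5/2)·nn_i`-ball), so the seam «TwoShellShape ⟹ GapFreeShells» suggested on the cell bus is not available; the honest seam is
the one proved here.

## The reduction (PROVED): `ShellHoleBound c → GapFreeShells` for `21/32 ≤ c`

`ShellHoleBound c`: at a `(1/100)`-charge-free site `i`, the bond vectors `y k − y i` `c`-cover all directions (every `u` has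
cosine `≥ c` with some bond).  `21/32 = 0.65625 ≥ cos 49.0°`.  Proof of the reduction: a bond `i ~ k` of the scale-free bond
graph reads `d_k := dist (y i) (y k) ≤ (101/100)·min(nn_i, nn_k)`, so `nn_k ≥ (100/101)·d_k` and `d_k ≤ (101/100)·nn_i ≤
(101/100)·r` for any other site `j` at distance `r` from `i`; if `j` is not bonded to `i`, `r < (9/7)·nn_i ≤ (9/7)·d_k`, and the
bond `k` makes cosine `≥ 21/32` with `y j − y i`, then `dist (y k) (y j)² ≤ r² + d_k² − (21/16)·r·d_k < (100/101)²·d_k² ≤ nn_k²`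
on `r/d_k ∈ [100/101, 9/7]` (a convex quadratic, negative at both ends: `−0.2995`, `−0.0147`) — contradicting `nn_k ≤ dist (y k) (y j)`.
(The sharp cone for the literal `9/7` is `cos φ* = (1 + (9/7)² − (100/101)²)/(2·9/7)`, `φ* = 49.41°`; `c = 21/32` keeps a margin.)

## Status of `ShellHoleBound (21/32)` [NEW leaf · one-shell · potential-free · scale-free · UNDECIDED · INSTRUMENTABLE]

It says: the twelve bond directions of a `1 %`-charge-free shell (twelve sites at radii `d_k ∈ [nn_i, 1.01·nn_i]`, pairwise
`≥ max(nn_k, nn_k') ≥ nn_i/1.01` apart — angular separation `≥ 59.34°` —, each bonded to EXACTLY four shell sites, ring number `4`)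
leave no empty spherical cap of angular radius `≥ 49.0°`.  Evidence gathered by lens-3 g27 (pure-python penalty descents, folder
`HOME/decomp-a2c-lens-3/g27/gapfree/`, no kit): (E1) WITHOUT the ring-number-`4` link condition the bound FAILS marginally — twelve
unit vectors with pairwise angle `≥ 59.34°` admit an empty cap of radius `49.41°` (found in `< 1 s`; `50.0°` not found), realised by a
distorted cuboctahedron with one square face opened (rim of four at `49.41°`, only `19–20` contacts, rim degrees `2–3`): the link
condition is LOAD-BEARING; (E2) WITH the link window (four nearest in `[59.34°, 60.0°]`, fifth nearest `≥ 60.4°`) descents seeded at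
the cuboctahedron / anticuboctahedron / random / pentagonal-rim reach an empty cap of `≈ 45.0°–45.2°` and no more (`45.5°` infeasible
in `10³` restarts) — the regular square face gives exactly `45°`; (E3) STRUCTURE: an empty `49°`-cap must sit inside a FACE of the
(planar, `4`-regular, `24`-edge, `14`-face) link polyhedron all of whose vertices are `≥ 49°` from the cap centre; a rhombic face with
sides `s ≤ 60.66°` has half-diagonals `a, b` with `cos a · cos b = cos s ≥ 0.49`, so `min(a,b) ≤ 45.6° < 49°` — triangles and
quadrilaterals cannot host the cap, only faces with `≥ 5` sides can; the face vectors `(t, q, p, h, …)` with `3t + 4q + 5p + 6h + ⋯ = 48`,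
`t + q + p + ⋯ = 14` have `q + 2p + 3h + ⋯ = 6`: `(8,6,0)` (cuboctahedral / anticuboctahedral types), `(9,4,1)`, `(10,2,2)`, `(11,0,3)`,
`(10,3,0,1)`, `(11,1,1,1)`, `(12,0,0,2)`, …; `(12,0,0,2)` (hexagonal antiprism) is impossible (an equilateral spherical hexagon of side
`≥ 59.34°` has circumradius `≥ 81.9°`, two of them collide), and at zero tolerance every pentagonal type is OVERDETERMINED (around a
vertex with three equilateral `60°`-triangles the pentagon angle is forced to `360° − 3·arccos(1/3) = 148.4°`; for `(11,0,3)` the vertex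
bookkeeping forces nine such vertices and three vertices in two pentagons with angles `109.47°`, i.e. equilateral spherical pentagons
with prescribed angles `(148.4°, 148.4°, 148.4°, 109.5°, 109.5°)` — five conditions on a two-parameter family).  PLAN beneath the leaf:
`ShellHoleBound (21/32) ⟸ (F1) «the link polyhedron of a 1 %-charge-free shell has only triangular and quadrilateral faces» ∧ (F2) the
rhombus lemma above` — (F2) is elementary; (F1) is a finite case analysis over the face vectors with `q + 2p + 3h + ⋯ = 6` minus `(8,6,0)`:
per candidate graph, the minimal edge-length spread of a spherical realisation with all non-edges longer than all edges must exceed the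
`1 %` window (INSTRUMENTABLE: census TAG 186 «I-GAPFREE»; certified version = interval arithmetic on a `≤ 21`-dimensional but
graph-structured problem).  KILL-TEST: a `4`-regular `1 %`-shell with a pentagonal (or larger) face.

Nothing here proves the summit `AtomisticToContinuum`; rung 0.
-/

noncomputable section

namespace Summit.AtomisticToContinuum.Crystallization.Theorems.OverbindingBudgetGapFreeShellHole

open Literature.Geometry.DiscreteGeometry (IsChargeFree bondGraph nearestDist nearestDist_le_dist nearestDist_nonneg
  bondGraph_adj)
open Summit.AtomisticToContinuum.Crystallization.Theorems.OverbindingBudgetMisfitCensusStatements (GapFreeShells)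

/-- **`ShellHoleBound c`** (one-shell covering-radius bound): at every `(1/100)`-charge-free site `i` of a finite injective
configuration, every direction `u` makes cosine `≥ c` with some bond vector `y k − y i` of `i`
(`c · ‖y k − y i‖ · ‖u‖ ≤ ⟪y k − y i, u⟫`).  With `c = 21/32 ≥ cos 49.0°`: no empty spherical cap of angular radius `49°` among the
twelve bond directions.  [NEW leaf beneath `GapFreeShells`; UNDECIDED; INSTRUMENTABLE (census TAG 186); evidence (E1)–(E3) in the
module docstring] -/
def ShellHoleBound (c : ℝ) : Prop :=
  ∀ (N : ℕ) (y : Fin N → EuclideanSpace ℝ (Fin 3)), Function.Injective y → ∀ i : Fin N, IsChargeFree (1 / 100 : ℝ) y i →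
    ∀ u : EuclideanSpace ℝ (Fin 3), ∃ k : Fin N, (bondGraph (1 / 100 : ℝ) y).Adj i k ∧
      c * (‖y k - y i‖ * ‖u‖) ≤ inner ℝ (y k - y i) u

/-- `ShellHoleBound` is monotone in the cosine: a finer cover is a cover. [this file] -/
theorem shellHoleBound_mono {c c' : ℝ} (hcc : c ≤ c') (h : ShellHoleBound c') : ShellHoleBound c := by
  intro N y hy i hi u
  obtain ⟨k, hk, hcos⟩ := h N y hy i hi u
  exact ⟨k, hk, (mul_le_mul_of_nonneg_right hcc (mul_nonneg (norm_nonneg _) (norm_nonneg _))).trans hcos⟩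

/-- **SEAM, PROVED: `ShellHoleBound c → GapFreeShells` for `21/32 ≤ c`.**  A non-bonded intruder `j` at distance
`r < (9/7)·nn_i` from a charge-free site `i` lies within `49°` of some bond `k` of `i`; then
`dist (y k) (y j)² ≤ r² + d_k² − (21/16)·r·d_k < (100/101)²·d_k² ≤ nn_k²` (because the bond reads `d_k ≤ (101/100)·min(nn_i, nn_k)`,
whence `(100/101)·d_k ≤ r` and `r < (9/7)·d_k`), contradicting `nn_k ≤ dist (y k) (y j)`. [this file] -/
theorem gapFreeShells_of_shellHoleBound {c : ℝ} (hc : (21 : ℝ) / 32 ≤ c) (h : ShellHoleBound c) : GapFreeShells := by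
  intro N y hy i hi j hji hnadj
  by_contra hlt
  rw [not_le] at hlt
  obtain ⟨k, hik, hcos⟩ := h N y hy i hi (y j - y i)
  obtain ⟨hik_ne, hbond⟩ := bondGraph_adj.1 hik
  have hkj : k ≠ j := fun hkj => hnadj (hkj ▸ hik)
  have hd_pos : 0 < dist (y i) (y k) := dist_pos.2 fun heq => hik_ne (hy heq)
  have hnn_i_r : nearestDist y i ≤ dist (y i) (y j) := nearestDist_le_dist y hji
  have hnn_i_d : nearestDist y i ≤ dist (y i) (y k) := nearestDist_le_dist y (Ne.symm hik_ne)
  have hnn_k_j : nearestDist y k ≤ dist (y k) (y j) := nearestDist_le_dist y hkj.symm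
  have hnn_k_0 : 0 ≤ nearestDist y k := nearestDist_nonneg y k
  have h1 : dist (y i) (y k) ≤ (1 + 1 / 100) * nearestDist y i :=
    hbond.trans (mul_le_mul_of_nonneg_left (min_le_left _ _) (by norm_num))
  have h2 : dist (y i) (y k) ≤ (1 + 1 / 100) * nearestDist y k :=
    hbond.trans (mul_le_mul_of_nonneg_left (min_le_right _ _) (by norm_num))
  have hnk : ‖y k - y i‖ = dist (y i) (y k) := by rw [dist_comm, dist_eq_norm]
  have hnj : ‖y j - y i‖ = dist (y i) (y j) := by rw [dist_comm, dist_eq_norm]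
  have hcos' : (21 : ℝ) / 32 * (dist (y i) (y k) * dist (y i) (y j)) ≤ inner ℝ (y k - y i) (y j - y i) := by
    calc (21 : ℝ) / 32 * (dist (y i) (y k) * dist (y i) (y j))
        ≤ c * (dist (y i) (y k) * dist (y i) (y j)) :=
          mul_le_mul_of_nonneg_right hc (mul_nonneg dist_nonneg dist_nonneg)
      _ = c * (‖y k - y i‖ * ‖y j - y i‖) := by rw [hnk, hnj]
      _ ≤ inner ℝ (y k - y i) (y j - y i) := hcos
  have hsq : dist (y k) (y j) ^ 2 =
      dist (y i) (y k) ^ 2 - 2 * inner ℝ (y k - y i) (y j - y i) + dist (y i) (y j) ^ 2 := by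
    have e : y k - y j = (y k - y i) - (y j - y i) := by abel
    rw [dist_eq_norm, e, norm_sub_sq_real, hnk, hnj]
  have hB : nearestDist y k * nearestDist y k ≤ dist (y k) (y j) * dist (y k) (y j) :=
    mul_le_mul hnn_k_j hnn_k_j hnn_k_0 dist_nonneg
  have hr_lo : dist (y i) (y k) ≤ (101 / 100) * dist (y i) (y j) := by linarith
  have hr_hi : dist (y i) (y j) ≤ 9 / 7 * dist (y i) (y k) := by linarith
  nlinarith [mul_nonneg (sub_nonneg.2 hr_lo) (sub_nonneg.2 hr_hi), hcos', hsq, hB, h2, hd_pos, hnn_k_0,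
    mul_pos hd_pos hd_pos]

/-- The instance used downstream: **`ShellHoleBound (21/32) → GapFreeShells`** (`21/32 ≥ cos 49.0°`). [this file] -/
theorem gapFreeShells_of_shellHoleBound_fortyNine (h : ShellHoleBound (21 / 32)) : GapFreeShells :=
  gapFreeShells_of_shellHoleBound le_rfl h

end Summit.AtomisticToContinuum.Crystallization.Theorems.OverbindingBudgetGapFreeShellHole

end
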